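import Summits.QuantumFields.GaugeBoot.TensorKronecker
import Summits.QuantumFields.GaugeBoot.WilsonLineObservables
import HarnessLib

/-!
# Twisted traces of closed-word holonomies are products of Wilson loops (gauge-boot, FFT 5/7)

HONEST FRAMING (cell `pub-gaugeboot`, page 1 of every file): the venture produces certified bounds
on lattice expectations at stated coupling, gauge group, dimension and torus size; NOT a mass gap,
NOT a continuum limit, NOT a string tension; NOT Yang–Mills-summit-bearing (barriers
`FixedCouplingUltralocality`, `PerturbativeInvisibility`). Combinatorial bookkeeping; no number
is certified. Fifth brick of the lane's first fundamental theorem for lattice gauge invariants.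

## Content

* `twistTrace_equiv` — twisted traces are invariant under relabelling the slots;
  ★ `twistTrace_option_none` / `twistTrace_option_some` — ELIMINATION OF ONE SLOT: for
  `σ : Perm (Option α)`, `twistTrace σ L` equals `tr (L none) · twistTrace σ' (L ∘ some)` if `σ`
  fixes the extra slot, and otherwise `twistTrace σ' L'` where `σ' = removeNone σ` bypasses the
  extra slot and `L'` MERGES the two letters meeting there (`L b₀ · L none` in slot `b₀ = σ⁻¹ none`).
  This is the cycle structure of a permutation read one slot at a time (Sengupta 1994, (2)/[GKS]
  Lemma 3.5: `tr((A₁ ⊗ ⋯ ⊗ A_k) P_σ) = ∏_{cycles} tr(A_{c})`), without ever naming a cycle.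
* `loopC r x w` — the complex Wilson loop `U ↦ tr ρ(hol_x(w) U)` as a continuous observable;
  `lineC` (complex Wilson line entries); `loopAlgebraC r x` — the unital `ℂ`-algebra generated by
  the Wilson loops of the closed words at the base point `x` (products = multi-trace loops).
* ★★ `exists_mem_loopAlgebraC_twistTrace` — for closed words `w₁ … w_p` at `x` and every
  `τ ∈ S_p`, the observable `U ↦ twistTrace τ (ρ(hol_x w_k U))_k` lies in `loopAlgebraC r x`:
  it is a product of Wilson loops of CONCATENATED closed words (induction on `p`, merging
  letters = concatenating words, `ρ(hol(u·v)) = ρ(hol u) ρ(hol v)`).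

References: A. Sengupta, Proc. AMS 121 (1994) 897–905, proof of Thm. 2; C. King, L. Gross,
A. Sengupta, J. Math. Phys. 30 (1989), Lemma 3.5. Folklore.
-/

noncomputable section

namespace Summit.QuantumFields.GaugeBoot

namespace TensorFFT

open Matrix Finset

/-! ## Eliminating one slot from a twisted trace -/

section Slots

variable {κ κ' n R : Type*} [Fintype κ] [DecidableEq κ] [Fintype κ'] [DecidableEq κ']
  [Fintype n] [DecidableEq n] [CommRing R]

omit [DecidableEq n] in
/-- Twisted traces are invariant under relabelling the slots. -/
theorem twistTrace_equiv (e : κ ≃ κ') (τ : Equiv.Perm κ) (L : κ → Matrix n n R) :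
    twistTrace τ L = twistTrace (e.permCongr τ) (fun k' => L (e.symm k')) := by
  rw [twistTrace_def, twistTrace_def]
  refine Fintype.sum_equiv (e.arrowCongr (Equiv.refl n)) _ _ fun c => ?_
  simp only [Equiv.arrowCongr_apply, Equiv.coe_refl, Function.comp_apply, Equiv.permCongr_apply,
    Equiv.symm_apply_apply, id_eq]
  exact Fintype.prod_equiv e _ _ fun k => by simp

variable {α : Type*} [Fintype α] [DecidableEq α]

omit [Fintype α] [DecidableEq α] in
/-- If `σ` fixes `none`, it maps `some a` to `some (removeNone σ a)`. -/
theorem perm_option_some_of_none (σ : Equiv.Perm (Option α)) (h : σ none = none) (a : α) :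
    σ (some a) = some (Equiv.removeNone σ a) := by
  rcases hs : σ (some a) with _ | a'
  · exact absurd (σ.injective (hs.trans h.symm)) (Option.some_ne_none a)
  · have h1 := Equiv.removeNone_some σ ⟨a', hs⟩
    rw [hs] at h1
    exact h1.symm

omit [DecidableEq n] in
/-- ★ **Slot elimination, fixed case**: if `σ` fixes the slot `none`, the twisted trace factors
off the trace of that letter. -/
theorem twistTrace_option_none (σ : Equiv.Perm (Option α)) (h : σ none = none)
    (L : Option α → Matrix n n R) :
    twistTrace σ L = (L none).trace * twistTrace (Equiv.removeNone σ) (fun a => L (some a)) := by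
  have hs := perm_option_some_of_none σ h
  rw [twistTrace_def, twistTrace_def, Matrix.trace, Finset.sum_mul_sum,
    ← (Equiv.piOptionEquivProd (β := fun _ : Option α => n)).symm.sum_comp, Fintype.sum_prod_type]
  refine sum_congr rfl fun x _ => sum_congr rfl fun c _ => ?_
  rw [Fintype.prod_option, Matrix.diag_apply]
  have e0 : ((Equiv.piOptionEquivProd (β := fun _ : Option α => n)).symm (x, c)) none = x := rfl
  have e1 : ∀ a, ((Equiv.piOptionEquivProd (β := fun _ : Option α => n)).symm (x, c)) (some a) = c a :=
    fun a => rfl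
  rw [h, e0]
  simp only [hs, e1]

omit [Fintype α] [DecidableEq α] in
/-- The slot sent to `none`: if `σ none = some a₀` then `σ (some b₀) = none` for
`b₀ = removeNone σ⁻¹ a₀`, and `removeNone σ b₀ = a₀`. -/
theorem perm_option_pre_none (σ : Equiv.Perm (Option α)) {a₀ : α} (h : σ none = some a₀) :
    σ (some (Equiv.removeNone σ.symm a₀)) = none ∧ Equiv.removeNone σ (Equiv.removeNone σ.symm a₀) = a₀ := by
  have h1 : σ.symm (some a₀) = none := by rw [Equiv.symm_apply_eq]; exact h.symm
  have h2 : some (Equiv.removeNone σ.symm a₀) = σ.symm none := Equiv.removeNone_none σ.symm h1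
  have h3 : σ (some (Equiv.removeNone σ.symm a₀)) = none := by
    rw [h2, Equiv.apply_symm_apply]
  refine ⟨h3, ?_⟩
  have h4 := Equiv.removeNone_none σ h3
  rw [h] at h4
  exact Option.some_injective _ h4

omit [Fintype α] [DecidableEq α] in
/-- Away from the slot sent to `none`, `σ (some a) = some (removeNone σ a)`. -/
theorem perm_option_some_of_ne (σ : Equiv.Perm (Option α)) {a₀ : α} (h : σ none = some a₀) {a : α}
    (ha : a ≠ Equiv.removeNone σ.symm a₀) : σ (some a) = some (Equiv.removeNone σ a) := by
  rcases hs : σ (some a) with _ | a'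
  · exfalso
    have h1 := (perm_option_pre_none σ h).1
    exact ha (Option.some_injective _ (σ.injective (hs.trans h1.symm)))
  · have h1 := Equiv.removeNone_some σ ⟨a', hs⟩
    rw [hs] at h1
    exact h1.symm

omit [DecidableEq n] in
/-- ★ **Slot elimination, moving case**: if `σ none = some a₀`, the twisted trace over `Option α`
is a twisted trace over `α` for the bypassing permutation `removeNone σ`, with the two letters
meeting at the eliminated slot MERGED: `L b₀ · L none` in slot `b₀ = removeNone σ⁻¹ a₀`. -/
theorem twistTrace_option_some (σ : Equiv.Perm (Option α)) {a₀ : α} (h : σ none = some a₀)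
    (L : Option α → Matrix n n R) :
    twistTrace σ L = twistTrace (Equiv.removeNone σ)
      (Function.update (fun a => L (some a)) (Equiv.removeNone σ.symm a₀)
        (L (some (Equiv.removeNone σ.symm a₀)) * L none)) := by
  set b₀ := Equiv.removeNone σ.symm a₀ with hb₀
  set σ' := Equiv.removeNone σ with hσ'
  obtain ⟨hb₁, hb₂⟩ := perm_option_pre_none σ h
  have hs : ∀ a, a ≠ b₀ → σ (some a) = some (σ' a) := fun a ha => perm_option_some_of_ne σ h ha
  set L' := Function.update (fun a => L (some a)) b₀ (L (some b₀) * L none) with hL'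
  rw [twistTrace_def, twistTrace_def,
    ← (Equiv.piOptionEquivProd (β := fun _ : Option α => n)).symm.sum_comp, Fintype.sum_prod_type,
    Finset.sum_comm]
  refine sum_congr rfl fun c _ => ?_
  have e0 : ∀ x : n, ((Equiv.piOptionEquivProd (β := fun _ : Option α => n)).symm (x, c)) none = x :=
    fun x => rfl
  have e1 : ∀ (x : n) a,
      ((Equiv.piOptionEquivProd (β := fun _ : Option α => n)).symm (x, c)) (some a) = c a :=
    fun x a => rfl
  -- split both products at the slot `b₀`
  have lhs : ∀ x : n, (∏ k : Option α, L k
      (((Equiv.piOptionEquivProd (β := fun _ : Option α => n)).symm (x, c)) k)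
      (((Equiv.piOptionEquivProd (β := fun _ : Option α => n)).symm (x, c)) (σ k))) =
      (L (some b₀) (c b₀) x * L none x (c a₀)) * ∏ a ∈ univ.erase b₀, L (some a) (c a) (c (σ' a)) := by
    intro x
    rw [Fintype.prod_option, h, e0, e1, ← Finset.mul_prod_erase univ _ (mem_univ b₀), hb₁, e1, e0]
    rw [← mul_assoc, mul_comm (L none x (c a₀))]
    congr 1
    refine prod_congr rfl fun a ha => ?_
    rw [hs a (ne_of_mem_erase ha), e1, e1]
  have rhs : ∏ a, L' a (c a) (c (σ' a)) =
      (L (some b₀) * L none) (c b₀) (c a₀) * ∏ a ∈ univ.erase b₀, L (some a) (c a) (c (σ' a)) := by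
    rw [← Finset.mul_prod_erase univ _ (mem_univ b₀), hL', Function.update_self, hσ', hb₂]
    congr 1
    refine prod_congr rfl fun a ha => ?_
    rw [Function.update_of_ne (ne_of_mem_erase ha)]
  simp_rw [lhs]
  rw [← Finset.sum_mul, rhs, Matrix.mul_apply]

end Slots

end TensorFFT

/-! ## Wilson loops as complex observables; the loop algebra at a base point -/

section Loops

open Matrix Finset TensorFFT
open Literature.MathematicalPhysics.QuantumFieldTheory (Site GaugeConfig LatticeRep)

variable {d L : ℕ} {G : Type*} [Group G] [TopologicalSpace G] [IsTopologicalGroup G] (r : LatticeRep G)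

/-- **Complex Wilson line entry** `U ↦ ρ(hol_x(w) U)_{ab}` as a continuous observable. [folklore] -/
def lineC (x : Site d L) (w : Word d) (a b : Fin r.N) : C(GaugeConfig d L G, ℂ) :=
  ⟨fun U => r.ρ (wordHolonomy U x w) a b, (continuous_rho_wordHolonomy r x w).matrix_elem a b⟩

/-- **Complex Wilson loop** `U ↦ tr ρ(hol_x(w) U)` as a continuous observable. [folklore] -/
def loopC (x : Site d L) (w : Word d) : C(GaugeConfig d L G, ℂ) :=
  ⟨fun U => (r.ρ (wordHolonomy U x w)).trace, (continuous_rho_wordHolonomy r x w).matrix_trace⟩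

/-- `lineC` evaluated. -/
@[simp] theorem lineC_apply (x : Site d L) (w : Word d) (a b : Fin r.N) (U : GaugeConfig d L G) :
    lineC r x w a b U = r.ρ (wordHolonomy U x w) a b := rfl

/-- `loopC` evaluated. -/
@[simp] theorem loopC_apply (x : Site d L) (w : Word d) (U : GaugeConfig d L G) :
    loopC r x w U = (r.ρ (wordHolonomy U x w)).trace := rfl

/-- **The (complex, multi-trace) Wilson loop algebra at `x`**: the unital `ℂ`-subalgebra of the
continuous observables generated by the Wilson loops `tr ρ(hol_x w)` of the closed words `w` at
`x`. [folklore] -/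
def loopAlgebraC (x : Site d L) : Subalgebra ℂ C(GaugeConfig d L G, ℂ) :=
  Algebra.adjoin ℂ {f | ∃ w : Word d, Word.endpoint x w = x ∧ f = loopC r x w}

/-- Wilson loops of closed words are in the loop algebra. -/
theorem loopC_mem_loopAlgebraC (x : Site d L) {w : Word d} (hw : Word.endpoint x w = x) :
    loopC r x w ∈ loopAlgebraC (d := d) (L := L) r x :=
  Algebra.subset_adjoin ⟨w, hw, rfl⟩

omit [IsTopologicalGroup G] in
/-- `ρ(hol_x(u · v)) = ρ(hol_x u) ρ(hol_x v)` for `u` closed at `x`. -/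
theorem rho_wordHolonomy_append_of_closed (U : GaugeConfig d L G) (x : Site d L) {u : Word d}
    (hu : Word.endpoint x u = x) (v : Word d) :
    r.ρ (wordHolonomy U x (u ++ v)) = r.ρ (wordHolonomy U x u) * r.ρ (wordHolonomy U x v) := by
  rw [wordHolonomy_append, hu, map_mul]

/-- ★★ **Twisted traces of closed-word holonomies are multi-trace Wilson loops**: for closed words
`w₁, …, w_p` at `x` and `τ ∈ S_p`, the observable `U ↦ twistTrace τ (ρ(hol_x w_k U))_k` lies in the
Wilson loop algebra at `x` (it is a product, over the cycles of `τ`, of the Wilson loops of the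
concatenated words). [folklore] -/
theorem exists_mem_loopAlgebraC_twistTrace (x : Site d L) :
    ∀ (p : ℕ) (τ : Equiv.Perm (Fin p)) (w : Fin p → Word d), (∀ k, Word.endpoint x (w k) = x) →
      ∃ F ∈ loopAlgebraC (d := d) (L := L) r x,
        ∀ U : GaugeConfig d L G, F U = twistTrace τ (fun k => r.ρ (wordHolonomy U x (w k))) := by
  intro p
  induction p with
  | zero =>
    intro τ w _
    refine ⟨1, Subalgebra.one_mem _, fun U => ?_⟩
    rw [twistTrace_def, ContinuousMap.one_apply]
    simp
  | succ p ih =>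
    intro τ w hw
    set e : Fin (p + 1) ≃ Option (Fin p) := finSuccEquiv p with he
    set σ : Equiv.Perm (Option (Fin p)) := e.permCongr τ with hσ
    have key : ∀ U : GaugeConfig d L G, twistTrace τ (fun k => r.ρ (wordHolonomy U x (w k))) =
        twistTrace σ (fun o => r.ρ (wordHolonomy U x (w (e.symm o)))) := fun U =>
      twistTrace_equiv e τ _
    rcases hnone : σ none with _ | a₀
    · -- the extra slot is a fixed point: a Wilson loop factors off
      obtain ⟨F', hF', hF'U⟩ := ih (Equiv.removeNone σ) (fun a => w (e.symm (some a))) (fun a => hw _)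
      refine ⟨loopC r x (w (e.symm none)) * F', Subalgebra.mul_mem _ (loopC_mem_loopAlgebraC r x (hw _)) hF',
        fun U => ?_⟩
      rw [key U, twistTrace_option_none σ hnone, ContinuousMap.mul_apply, hF'U, loopC_apply]
    · -- the extra slot lies on a cycle: merge the two words meeting there
      set b₀ := Equiv.removeNone σ.symm a₀ with hb₀
      let w' : Fin p → Word d :=
        Function.update (fun a => w (e.symm (some a))) b₀ (w (e.symm (some b₀)) ++ w (e.symm none))
      have hw' : ∀ a, Word.endpoint x (w' a) = x := by
        intro a
        by_cases ha : a = b₀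
        · subst ha
          simp only [w', Function.update_self, Word.endpoint_append, hw]
        · simp only [w', Function.update_of_ne ha, hw]
      obtain ⟨F', hF', hF'U⟩ := ih (Equiv.removeNone σ) w' hw'
      refine ⟨F', hF', fun U => ?_⟩
      rw [key U, twistTrace_option_some σ hnone, hF'U, ← hb₀]
      congr 1
      funext a
      by_cases ha : a = b₀
      · rw [ha, Function.update_self]
        simp only [w', Function.update_self]
        exact rho_wordHolonomy_append_of_closed r U x (hw (e.symm (some b₀))) (w (e.symm none))
      · rw [Function.update_of_ne ha]
        simp only [w', Function.update_of_ne ha]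

end Loops

end Summit.QuantumFields.GaugeBoot

end
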